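import Summits.ResolutionOfSingularities.ResolutionOfSingularities.Theorems.PurelyInseparableDim4Perm2BoundOrigin
import Summits.ResolutionOfSingularities.ResolutionOfSingularities.Theorems.PurelyInseparableDim4NearDim
import Literature.AlgebraicGeometry.Resolution.WeightedBlowupNoIncrease
import HarnessLib

/-!
# [OURS · res-dim4-pi PR-4K] Lemma K: kept exceptional components keep their RE-READ multiplicity
  EXACTLY under a coordinate-centre step at every point of the chart (clean `F`, condition (1))

Cell `res-dim4-pi` (D-0157 DOOR 2, wave 2), brick **PR-4K** = the "Lemma K" part of the desk's re-scoped PR-4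
(`boards/ROUTES.md` WORD #14 (h); critic B, V-B-02 (c)), seat `res-dim4-p-6`.  Typed over the TREE's model
`CentreBlowup.CState / step / chartTransform / newMult / newExc / ordAlong / degIn` (`PointBlowupShadeCentres`)
and the landed cell files `…Perm2BoundOrigin` (p-2: the chart law is injective and reflects `q`-th powers
under condition (1)), `…NearDim` (p-3: `step_r_self`).  Nothing is restated; no definition is introduced.

THE QUESTION.  The engines RE-READ the exceptional multiplicities after every step (`r′_i := ord_{(x_i)} F′`
on the components through the new point); the tree's `step` CARRIES them by the formula `newMult`
(`r′_i = r_i` kept, `r′_j = ord_{C_S} F − q` new, `0` lost).  After the translation `x ↦ x + b` and the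
deletion of the `q`-th-power monomials, could every monomial of the lowest `x_i`-layer cancel?  No:

* §1 `coeff_translate_eq_coeff_of_maximal`: a monomial of `P` dominated by no other (`γ ≤ e` with equality
  at every untranslated coordinate forces `e = γ`) keeps its coefficient VERBATIM in `translate b P`; every
  non-empty domination-closed layer has such a monomial (one of maximal degree), so at an UNtranslated
  coordinate `m` every value `e_m` on the support of `P` survives (`exists_mem_support_translate_apply_eq`).
* §2 for clean `F`, `j ∈ S`, condition (1) (`q ≤ degIn S e` on the support), any `b`: the surviving monomial
  is not a `q`-th power (p-2's `isPthPowerExponent_chartExponent_iff`), hence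
  `ordAlong_singleton_step_eq_chartTransform : ord_{(x_m)} (step …).F = ord_{(x_m)} (chartTransform …)`.
* §3 **LEMMA K** `ordAlong_singleton_step_of_kept : ord_{(x_i)} (step q S j b s).F = ord_{(x_i)} F` at every
  KEPT index (`i ≠ j`, `b_i = 0`; translations on `S ∖ {j}` AND along the centre allowed);
  `ordAlong_singleton_step_self : ord_{(x_j)} (step …).F = ord_{C_S} F − q` (new component, exact);
  `step_F_ne_zero_of_clean` at EVERY point of the chart, every field, every `q` (the tree's
  `CentreBlowup.step_F_ne_zero` is the fibre-over-the-origin case).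
* §4 ENGINE ↔ MODEL DICTIONARY: `newMult` IS the re-read multiplicity after the step on every kept component
  and on the new one, if it was before (`step_r_eq_toNat_ordAlong_of_kept`, `step_r_self_eq_toNat_ordAlong`,
  `forall_exc_step_r_eq_toNat_ordAlong`).
* Part 2 (`…KeptMultiplicityCell.lean`, cell words, `σ = Fin 4`): «clean ∧ `r` re-read on `exc`» is
  preserved along every `Edge` in a permissible coordinate centre, hence along every branch of every mode.

Scope (honest): LOST components (`b_i ≠ 0`) get `r′_i = 0` in the model while the re-read `ord_{(x_i)} F′`
may be positive (`q = 2`, `F = x₁³(x₂ + 1)`, `S = {1}`, `b₂ = −1`: `F′ = x₁x₂`) — they have left `exc`, so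
§4 and part 2 speak of `exc` and kept indices only.  Coordinate centres; perfect-field cleaning.
[OURS · counted 0 · elementary · AI kernel work, weaker than expert review.]  NOTHING here is a statement
about resolution of singularities; resolution in dimension `≥ 4` / characteristic `p > 0` is NOT proved by
anything in this file.  bears_on: LADDER-RESOLUTION:D157-DOOR2 (res-dim4-pi · PR-4K).  Host item (DR-157-C):
`stmt-ResolutionOfSingularities-16155` (`MarkedTransfer.HypersurfaceOrderReduction`), helper.
-/

noncomputable section

set_option linter.dupNamespace false -- mandated namespace of this single-conjunct summit

open MvPolynomial Finset

open scoped BigOperators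

namespace Summit.ResolutionOfSingularities.ResolutionOfSingularities.Theorems.PIDim4

namespace KeptMultiplicity

open Literature.AlgebraicGeometry.Resolution
open Literature.AlgebraicGeometry.Resolution.CentreBlowup
open Literature.AlgebraicGeometry.Resolution.Hauser2010

section General

variable {σ : Type*} {K : Type*} [Field K] [Fintype σ] [DecidableEq σ] [DecidableEq K]

/-! ## §1 Translations keep the coefficient of an undominated monomial -/

omit [DecidableEq K] in
/-- **An undominated monomial keeps its coefficient under translation.**  If no monomial `x^e ≠ x^γ` of
`P` satisfies `γ ≤ e` with `e_m = γ_m` at every untranslated coordinate (`b_m = 0`), then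
`coeff γ (translate b P) = coeff γ P`: by the Taylor formula `x^γ` is produced only by such `x^e`
(tree `PointBlowup.le_of_coeff_translate_monomial_ne_zero` / `…apply_eq_of_coeff_translate_monomial_ne_zero`),
and `x^γ` itself contributes its own coefficient (`WeightedBlowup.coeff_translate_monomial_self`).
OURS (elementary). [folklore] -/
theorem coeff_translate_eq_coeff_of_maximal (b : σ → K) (P : MvPolynomial σ K) {γ : σ →₀ ℕ}
    (hmax : ∀ e ∈ P.support, γ ≤ e → (∀ m, b m = 0 → γ m = e m) → e = γ) :
    coeff γ (PointBlowup.translate b P) = coeff γ P := by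
  have hvanish : ∀ e ∈ P.support, e ≠ γ →
      coeff γ (PointBlowup.translate b (monomial e (coeff e P))) = 0 := by
    intro e he hne
    by_contra h
    exact hne (hmax e he (PointBlowup.le_of_coeff_translate_monomial_ne_zero b h)
      (fun m hm => PointBlowup.apply_eq_of_coeff_translate_monomial_ne_zero b hm h))
  rw [PointBlowup.translate_eq_sum_support, coeff_sum]
  by_cases hγ : γ ∈ P.support
  · rw [Finset.sum_eq_single γ (fun e he hne => hvanish e he hne) (fun h => (h hγ).elim)]
    exact WeightedBlowup.coeff_translate_monomial_self b γ _
  · rw [MvPolynomial.notMem_support_iff.mp hγ]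
    exact Finset.sum_eq_zero fun e he => hvanish e he (fun h => hγ (h ▸ he))

omit [DecidableEq K] in
/-- **Every domination-closed non-empty layer has an undominated monomial.**  If `A` is a non-empty set
of monomials of `P` such that every monomial of `P` dominating a member of `A` (in the sense of
`coeff_translate_eq_coeff_of_maximal`) lies again in `A`, then some `x^γ`, `γ ∈ A`, keeps its coefficient
in `translate b P` — any member of `A` of maximal total degree (a strict dominator has larger degree,
tree `PointBlowup.degree_lt_degree_of_lt`). OURS (elementary). [folklore] -/
theorem exists_coeff_translate_eq_of_layer (b : σ → K) (P : MvPolynomial σ K)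
    (A : Finset (σ →₀ ℕ)) (hne : A.Nonempty)
    (hclosed : ∀ γ ∈ A, ∀ e ∈ P.support, γ ≤ e → (∀ m, b m = 0 → γ m = e m) → e ∈ A) :
    ∃ γ ∈ A, coeff γ (PointBlowup.translate b P) = coeff γ P := by
  obtain ⟨γ, hγA, hγmax⟩ := Finset.exists_max_image A (fun e : σ →₀ ℕ => e.degree) hne
  refine ⟨γ, hγA, coeff_translate_eq_coeff_of_maximal b P fun e he hle hagree => ?_⟩
  have hdeg : e.degree ≤ γ.degree := hγmax e (hclosed γ hγA e he hle hagree)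
  by_contra hneγ
  exact absurd (PointBlowup.degree_lt_degree_of_lt (lt_of_le_of_ne hle (Ne.symm hneγ)))
    (not_lt.mpr hdeg)

omit [DecidableEq K] in
/-- **At an untranslated coordinate every exponent value survives the translation**: if `b_m = 0` and
`x^{e₀}` is a monomial of `P`, then `translate b P` has a monomial `x^γ` with `γ_m = (e₀)_m`, `γ` itself a
monomial of `P` with its coefficient kept (the layer `{e ∈ supp P : e_m = (e₀)_m}` is domination-closed
because dominators agree at untranslated coordinates). OURS (elementary). [folklore] -/
theorem exists_mem_support_translate_apply_eq (b : σ → K) (P : MvPolynomial σ K) {m : σ}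
    (hbm : b m = 0) {e₀ : σ →₀ ℕ} (he₀ : e₀ ∈ P.support) :
    ∃ γ ∈ P.support, γ m = e₀ m ∧ coeff γ (PointBlowup.translate b P) = coeff γ P := by
  obtain ⟨γ, hγA, hγ⟩ := exists_coeff_translate_eq_of_layer b P
    (P.support.filter fun e => e m = e₀ m) ⟨e₀, Finset.mem_filter.mpr ⟨he₀, rfl⟩⟩
    (fun γ hγ e he _ hagree => by
      rw [Finset.mem_filter] at hγ ⊢
      exact ⟨he, (hagree m hbm).symm.trans hγ.2⟩)
  rw [Finset.mem_filter] at hγA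
  exact ⟨γ, hγA.1, hγA.2, hγ⟩

omit [DecidableEq K] in
/-- Conversely, a monomial `x^β` of `translate b P` agrees at every untranslated coordinate `m` with some
monomial of `P` (tree `PointBlowup.apply_eq_of_coeff_translate_monomial_ne_zero`). OURS (bookkeeping). [folklore] -/
theorem exists_apply_eq_of_mem_support_translate (b : σ → K) (P : MvPolynomial σ K) {m : σ}
    (hbm : b m = 0) {β : σ →₀ ℕ} (hβ : β ∈ (PointBlowup.translate b P).support) :
    ∃ e ∈ P.support, β m = e m := by
  have h := MvPolynomial.mem_support_iff.mp hβ
  rw [PointBlowup.translate_eq_sum_support, coeff_sum] at h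
  obtain ⟨e, he, hne⟩ := Finset.exists_ne_zero_of_sum_ne_zero h
  exact ⟨e, he, PointBlowup.apply_eq_of_coeff_translate_monomial_ne_zero b hbm hne⟩

/-! ## §2 The step: untranslated coordinates read the chart transform -/

/-- **A monomial of the chart transform survives the step at every untranslated coordinate.**  For a
clean `F` under condition (1) (`j ∈ S`, `q ≤ degIn S e` on the support) and `b_m = 0`: every value `E_m`
attained on the support of `chartTransform q S j F` is attained on the support of `(step q S j b s).F`.
The undominated monomial of §1 keeps its (non-zero) coefficient under the translation and is not deleted
by the cleaning, since the chart law reflects `q`-th powers (p-2's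
`Perm2Bound.isPthPowerExponent_chartExponent_iff`) and `F` is clean. OURS (elementary).
[cite: Hauser2010, §§F–G (blowup followed by cleaning)] -/
theorem exists_mem_support_step_apply_eq {q : ℕ} {S : Finset σ} {j : σ} (hj : j ∈ S) (b : σ → K)
    (s : CState σ K) (hclean : deletePthPowers q s.F = s.F) (hq : ∀ e ∈ s.F.support, q ≤ degIn S e)
    {m : σ} (hbm : b m = 0) {E₀ : σ →₀ ℕ} (hE₀ : E₀ ∈ (chartTransform q S j s.F).support) :
    ∃ E ∈ (step q S j b s).F.support, E m = E₀ m := by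
  obtain ⟨γ, hγ, hγm, hcoeff⟩ :=
    exists_mem_support_translate_apply_eq b (chartTransform q S j s.F) hbm hE₀
  refine ⟨γ, ?_, hγm⟩
  have hnot : ¬ IsPthPowerExponent q γ := by
    obtain ⟨e, he, heγ⟩ := Perm2Bound.exists_of_mem_support_chartTransform q S j s.F hγ
    rw [← heγ, Perm2Bound.isPthPowerExponent_chartExponent_iff hj (hq e he)]
    exact PointBlowup.not_isPthPowerExponent_of_clean q hclean he
  rw [MvPolynomial.mem_support_iff]
  show coeff γ (deletePthPowers q (PointBlowup.translate b (chartTransform q S j s.F))) ≠ 0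
  rw [coeff_deletePthPowers, if_neg hnot, hcoeff]
  exact MvPolynomial.mem_support_iff.mp hγ

/-- Conversely every monomial of `(step q S j b s).F` agrees at an untranslated coordinate `m` with some
monomial of the chart transform (cleaning deletes monomials and creates none; translation, §1).
OURS (bookkeeping). [cite: Hauser2010, §§F–G (blowup followed by cleaning)] -/
theorem exists_apply_eq_of_mem_support_step (q : ℕ) (S : Finset σ) (j : σ) (b : σ → K)
    (s : CState σ K) {m : σ} (hbm : b m = 0) {E : σ →₀ ℕ} (hE : E ∈ (step q S j b s).F.support) :
    ∃ E₀ ∈ (chartTransform q S j s.F).support, E m = E₀ m := by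
  have h := MvPolynomial.mem_support_iff.mp hE
  change coeff E (deletePthPowers q (PointBlowup.translate b (chartTransform q S j s.F))) ≠ 0 at h
  rw [coeff_deletePthPowers] at h
  split_ifs at h with hP
  · exact (h rfl).elim
  · exact exists_apply_eq_of_mem_support_translate b _ hbm (MvPolynomial.mem_support_iff.mpr h)

/-- **At an untranslated coordinate the step reads the chart transform**: for clean `F`, `j ∈ S`,
condition (1) and `b_m = 0`, `ord_{(x_m)} (step q S j b s).F = ord_{(x_m)} (chartTransform q S j F)` —
translation and cleaning change nothing there. OURS (elementary).
[cite: Hauser2010, §§F–G (blowup followed by cleaning)] -/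
theorem ordAlong_singleton_step_eq_chartTransform {q : ℕ} {S : Finset σ} {j : σ} (hj : j ∈ S)
    (b : σ → K) (s : CState σ K) (hclean : deletePthPowers q s.F = s.F)
    (hq : ∀ e ∈ s.F.support, q ≤ degIn S e) {m : σ} (hbm : b m = 0) :
    ordAlong {m} (step q S j b s).F = ordAlong {m} (chartTransform q S j s.F) := by
  apply le_antisymm
  · refine le_ordAlong_iff.mpr fun E₀ hE₀ => ?_
    obtain ⟨E, hE, hEm⟩ := exists_mem_support_step_apply_eq hj b s hclean hq hbm hE₀
    calc ordAlong {m} (step q S j b s).F ≤ (degIn {m} E : ℕ∞) := ordAlong_le_of_mem_support hE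
      _ = (degIn {m} E₀ : ℕ∞) := by rw [degIn_singleton, degIn_singleton, hEm]
  · refine le_ordAlong_iff.mpr fun E hE => ?_
    obtain ⟨E₀, hE₀, hEm⟩ := exists_apply_eq_of_mem_support_step q S j b s hbm hE
    calc ordAlong {m} (chartTransform q S j s.F) ≤ (degIn {m} E₀ : ℕ∞) := ordAlong_le_of_mem_support hE₀
      _ = (degIn {m} E : ℕ∞) := by rw [degIn_singleton, degIn_singleton, hEm]

omit [Fintype σ] [DecidableEq K] in
/-- The chart law keeps every coordinate off `j`, so `ord_{(x_i)} (chartTransform q S j F) = ord_{(x_i)} F`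
for `i ≠ j` (`j ∈ S`, condition (1): p-2's `Perm2Bound.mem_support_chartTransform_iff`). OURS (bookkeeping).
[cite: HauserPerlega2019PRIMS, §2 (the blowup in the x₁-chart)] -/
theorem ordAlong_singleton_chartTransform_of_ne {q : ℕ} {S : Finset σ} {j i : σ} (hj : j ∈ S)
    (hij : i ≠ j) {F : MvPolynomial σ K} (hq : ∀ e ∈ F.support, q ≤ degIn S e) :
    ordAlong {i} (chartTransform q S j F) = ordAlong {i} F := by
  apply le_antisymm
  · refine le_ordAlong_iff.mpr fun e he => ?_
    have hmem : chartExponent q S j e ∈ (chartTransform q S j F).support :=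
      (Perm2Bound.mem_support_chartTransform_iff hj hq (hq e he)).mpr he
    calc ordAlong {i} (chartTransform q S j F) ≤ (degIn {i} (chartExponent q S j e) : ℕ∞) :=
          ordAlong_le_of_mem_support hmem
      _ = (degIn {i} e : ℕ∞) := by
          rw [degIn_singleton, degIn_singleton, chartExponent_apply_of_ne q S hij]
  · refine le_ordAlong_iff.mpr fun E hE => ?_
    obtain ⟨e, he, heE⟩ := Perm2Bound.exists_of_mem_support_chartTransform q S j F hE
    calc ordAlong {i} F ≤ (degIn {i} e : ℕ∞) := ordAlong_le_of_mem_support he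
      _ = (degIn {i} E : ℕ∞) := by
          rw [degIn_singleton, degIn_singleton, ← heE, chartExponent_apply_of_ne q S hij]

omit [Fintype σ] [DecidableEq K] in
/-- The chart law at `j`: `ord_{(x_j)} (chartTransform q S j F) = ord_{C_S} F − q` (`E_j = degIn S e − q`,
tree `CentreBlowup.chartExponent_apply_self`; `⊤ − q = ⊤` covers `F = 0`). OURS (bookkeeping).
[cite: HauserPerlega2019PRIMS, §2 (transform D' of D)] -/
theorem ordAlong_singleton_chartTransform_self {q : ℕ} {S : Finset σ} {j : σ} (hj : j ∈ S)
    {F : MvPolynomial σ K} (hq : ∀ e ∈ F.support, q ≤ degIn S e) :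
    ordAlong {j} (chartTransform q S j F) = ordAlong S F - q := by
  by_cases hF : F = 0
  · subst hF
    rw [chartTransform_zero, ordAlong_zero, ordAlong_zero, ENat.top_sub_coe]
  apply le_antisymm
  · obtain ⟨e, he, hoe⟩ := exists_mem_support_ordAlong_eq S hF
    have hmem : chartExponent q S j e ∈ (chartTransform q S j F).support :=
      (Perm2Bound.mem_support_chartTransform_iff hj hq (hq e he)).mpr he
    calc ordAlong {j} (chartTransform q S j F) ≤ (degIn {j} (chartExponent q S j e) : ℕ∞) :=
          ordAlong_le_of_mem_support hmem
      _ = ((degIn S e - q : ℕ) : ℕ∞) := by rw [degIn_singleton, chartExponent_apply_self]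
      _ = ordAlong S F - q := by rw [hoe, ENat.coe_sub]
  · refine le_ordAlong_iff.mpr fun E hE => ?_
    obtain ⟨e, he, heE⟩ := Perm2Bound.exists_of_mem_support_chartTransform q S j F hE
    calc ordAlong S F - q ≤ (degIn S e : ℕ∞) - q := tsub_le_tsub_right (ordAlong_le_of_mem_support he) _
      _ = ((degIn S e - q : ℕ) : ℕ∞) := (ENat.coe_sub _ _).symm
      _ = (degIn {j} E : ℕ∞) := by rw [degIn_singleton, ← heE, chartExponent_apply_self]

/-! ## §3 Lemma K -/

/-- **LEMMA K (kept components keep their re-read multiplicity exactly).**  For a clean `F`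
(`deletePthPowers q F = F`), a coordinate centre with `j ∈ S` and condition (1) (`q ≤ degIn S e` on the
support), and ANY point `b` of the `x_j`-chart: at every KEPT index `i` (`i ≠ j`, `b_i = 0` — translations
on the other coordinates of `S` and along the centre are allowed) `ord_{(x_i)} (step q S j b s).F =
ord_{(x_i)} F`.  Critic B's argument (res-dim4-crit-2, V-B-02 (c) «Lemma K»): the monomial of the lowest
`x_i`-layer that is maximal among its translates is produced by no other monomial, so it survives the
translation with its coefficient verbatim, and it is not a `q`-th power because `F` is clean.
OURS (elementary; the desk's PR-4 re-scope, WORD #14 (h)). [cite: Hauser2010, §F (transform D' of the exceptional divisor)] -/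
theorem ordAlong_singleton_step_of_kept {q : ℕ} {S : Finset σ} {j : σ} (hj : j ∈ S) (b : σ → K)
    (s : CState σ K) (hclean : deletePthPowers q s.F = s.F) (hq : ∀ e ∈ s.F.support, q ≤ degIn S e)
    {i : σ} (hij : i ≠ j) (hbi : b i = 0) :
    ordAlong {i} (step q S j b s).F = ordAlong {i} s.F := by
  rw [ordAlong_singleton_step_eq_chartTransform hj b s hclean hq hbi,
    ordAlong_singleton_chartTransform_of_ne hj hij hq]

/-- **The new component's re-read multiplicity is exact**: `ord_{(x_j)} (step q S j b s).F = ord_{C_S} F − q`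
at every point `b` of the `x_j`-chart (`b_j = 0`), for clean `F`, `j ∈ S`, condition (1).  The divisibility
half (`x_j^{r′_j} ∣ F′`) is p-3's `NearDim.X_pow_step_r_dvd_step_F`; exactness is §1 at `m = j`.
OURS (elementary). [cite: HauserPerlega2019PRIMS, §2 (transform D' of D)] -/
theorem ordAlong_singleton_step_self {q : ℕ} {S : Finset σ} {j : σ} (hj : j ∈ S) (b : σ → K)
    (hbj : b j = 0) (s : CState σ K) (hclean : deletePthPowers q s.F = s.F)
    (hq : ∀ e ∈ s.F.support, q ≤ degIn S e) :
    ordAlong {j} (step q S j b s).F = ordAlong S s.F - q := by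
  rw [ordAlong_singleton_step_eq_chartTransform hj b s hclean hq hbj,
    ordAlong_singleton_chartTransform_self hj hq]

/-- **A clean permissible non-zero `F` never steps to zero, at ANY point of the chart** (`j ∈ S`,
`b_j = 0`, condition (1)): the undominated monomial of lowest `C_S`-order survives.  The tree's
`CentreBlowup.step_F_ne_zero` is the fibre-over-the-origin case in characteristic `p`; here every field,
every `q`, every `b`. OURS (elementary). [cite: Hauser2010, §§F–G (blowup followed by cleaning)] -/
theorem step_F_ne_zero_of_clean {q : ℕ} {S : Finset σ} {j : σ} (hj : j ∈ S) (b : σ → K)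
    (hbj : b j = 0) (s : CState σ K) (hclean : deletePthPowers q s.F = s.F)
    (hq : ∀ e ∈ s.F.support, q ≤ degIn S e) (hF : s.F ≠ 0) : (step q S j b s).F ≠ 0 := by
  obtain ⟨e, he⟩ := MvPolynomial.support_nonempty.mpr hF
  have hmem : chartExponent q S j e ∈ (chartTransform q S j s.F).support :=
    (Perm2Bound.mem_support_chartTransform_iff hj hq (hq e he)).mpr he
  obtain ⟨E, hE, -⟩ := exists_mem_support_step_apply_eq hj b s hclean hq hbj hmem
  exact MvPolynomial.support_nonempty.mp ⟨E, hE⟩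

/-! ## §4 The engine ↔ model dictionary for the multiplicities -/

omit [Fintype σ] in
/-- The model's bookkeeping at a kept index: `(step q S j b s).r i = r_i` for `i ≠ j`, `b_i = 0`
(tree `CentreBlowup.newMult`, by definition). [cite: Hauser2010, §F (transform D' of the exceptional divisor)] -/
theorem step_r_apply_of_kept (q : ℕ) (S : Finset σ) {j i : σ} (hij : i ≠ j) (b : σ → K)
    (hbi : b i = 0) (s : CState σ K) : (step q S j b s).r i = s.r i := by
  show newMult q S j b s i = _
  unfold newMult
  rw [Finsupp.update_apply, if_neg hij, Finsupp.filter_apply, if_pos hbi]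

omit [Fintype σ] in
/-- The model's bookkeeping at a lost index: `(step q S j b s).r i = 0` for `i ≠ j`, `b_i ≠ 0`
(tree `CentreBlowup.newMult`, by definition). [cite: Hauser2010, §F (transform D' of the exceptional divisor)] -/
theorem step_r_apply_of_lost (q : ℕ) (S : Finset σ) {j i : σ} (hij : i ≠ j) (b : σ → K)
    (hbi : b i ≠ 0) (s : CState σ K) : (step q S j b s).r i = 0 := by
  show newMult q S j b s i = _
  unfold newMult
  rw [Finsupp.update_apply, if_neg hij, Finsupp.filter_apply, if_neg hbi]

/-- **Dictionary, kept component**: if `r_i` was the re-read multiplicity `ord_{(x_i)} F` (as a natural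
number) before the step, then the model's `r′_i` is the re-read multiplicity after it (`i ≠ j`, `b_i = 0`;
clean `F`, `j ∈ S`, condition (1)). OURS (Lemma K + the model's bookkeeping).
[cite: Hauser2010, §F (transform D' of the exceptional divisor)] -/
theorem step_r_eq_toNat_ordAlong_of_kept {q : ℕ} {S : Finset σ} {j : σ} (hj : j ∈ S) (b : σ → K)
    (s : CState σ K) (hclean : deletePthPowers q s.F = s.F) (hq : ∀ e ∈ s.F.support, q ≤ degIn S e)
    {i : σ} (hij : i ≠ j) (hbi : b i = 0) (hread : s.r i = (ordAlong {i} s.F).toNat) :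
    (step q S j b s).r i = (ordAlong {i} (step q S j b s).F).toNat := by
  rw [step_r_apply_of_kept q S hij b hbi s, hread, ordAlong_singleton_step_of_kept hj b s hclean hq hij hbi]

/-- **Dictionary, new component**: the model's `r′_j = ord_{C_S} F − q` (p-3's `NearDim.step_r_self`) IS
the re-read multiplicity `ord_{(x_j)} F′` after the step (`b_j = 0`; clean `F`, `j ∈ S`, condition (1)),
unconditionally on the old `r`. OURS (elementary). [cite: HauserPerlega2019PRIMS, §2 (transform D' of D)] -/
theorem step_r_self_eq_toNat_ordAlong {q : ℕ} {S : Finset σ} {j : σ} (hj : j ∈ S) (b : σ → K)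
    (hbj : b j = 0) (s : CState σ K) (hclean : deletePthPowers q s.F = s.F)
    (hq : ∀ e ∈ s.F.support, q ≤ degIn S e) :
    (step q S j b s).r j = (ordAlong {j} (step q S j b s).F).toNat := by
  rw [NearDim.step_r_self, ordAlong_singleton_step_self hj b hbj s hclean hq,
    ENat.toNat_sub (ENat.coe_ne_top q), ENat.toNat_coe]

omit [Fintype σ] in
/-- The model's new set of components through the point: `(step q S j b s).exc = insert j {i ∈ exc : b_i = 0}`
(tree `CentreBlowup.newExc`, by definition). [cite: Hauser2010, §F (transform D')] -/
theorem mem_step_exc_iff (q : ℕ) (S : Finset σ) (j : σ) (b : σ → K) (s : CState σ K) (i : σ) :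
    i ∈ (step q S j b s).exc ↔ i = j ∨ (i ∈ s.exc ∧ b i = 0) := by
  show i ∈ newExc j b s ↔ _
  unfold newExc
  rw [Finset.mem_insert, Finset.mem_filter]

/-- **Dictionary on the model's `exc`**: if every component through the point carried its re-read
multiplicity before the step (`r_i = ord_{(x_i)} F` for `i ∈ exc`), then so does every component through
the new point after it (`b_j = 0`; clean `F`, `j ∈ S`, condition (1)) — the new component by
`step_r_self_eq_toNat_ordAlong`, the kept old ones by Lemma K, the lost ones having left `exc`.
OURS (elementary). [cite: Hauser2010, §F (transform D' of the exceptional divisor)] -/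
theorem forall_exc_step_r_eq_toNat_ordAlong {q : ℕ} {S : Finset σ} {j : σ} (hj : j ∈ S)
    (b : σ → K) (hbj : b j = 0) (s : CState σ K) (hclean : deletePthPowers q s.F = s.F)
    (hq : ∀ e ∈ s.F.support, q ≤ degIn S e)
    (hread : ∀ i ∈ s.exc, s.r i = (ordAlong {i} s.F).toNat) :
    ∀ i ∈ (step q S j b s).exc, (step q S j b s).r i = (ordAlong {i} (step q S j b s).F).toNat := by
  intro i hi
  by_cases hij : i = j
  · subst hij
    exact step_r_self_eq_toNat_ordAlong hj b hbj s hclean hq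
  · rcases (mem_step_exc_iff q S j b s i).mp hi with h | ⟨hexc, hbi⟩
    · exact (hij h).elim
    · exact step_r_eq_toNat_ordAlong_of_kept hj b s hclean hq hij hbi (hread i hexc)

end General

end KeptMultiplicity

end Summit.ResolutionOfSingularities.ResolutionOfSingularities.Theorems.PIDim4

end
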